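import Literature.NumberTheory.Sieve.GoldstonPintzYildirimLemma3Bound
import HarnessLib

/-!
# Goldston–Pintz–Yıldırım, Lemma 3 — the `o(1)` form (parameter choice and asymptotics)

Trunk: NumberTheory / Sieve, continuing `GoldstonPintzYildirimLemma3Bound` (GPY, *Primes in
tuples I*, §8, Lemma 3, (8.4)–(8.6)). The explicit bound `norm_lemma3T_sub_main_le` is
specialised to the contour parameters (in the variable `x = log log R`, `y = eˣ = log R`)

  `η = 1/log R`, `θ = 4/log R`, `η₀ = ρ = 1/log log R`, `T = (log R)^{A₀}` (`A₀ = 3M + 3`),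
  `σ₀ = σ_w = c̄/log(3T + 5)`, `κ = 3/log log R`,

shown admissible for `x ≥ x₀(M, c̄, ρ_W)` (`lemma3_params`, `exists_sq_le_exp`), and each of the six
error terms is bounded by `cᵢ(M) · B · x^{5M+1} · (log R)^{u+v+d}/log R` (`lemma3ErrT_le`, …,
`lemma3ErrD_le`; the savings are `R^{−σ} = exp(−c̄ log R/ log(3T+5)) ≤ (log R)^{−(M+2)}` on the
left edges, `1/T` on tails and horizontal edges, `η = 1/log R` on the perturbation of the double
residue and on the diagonal term). The result is **Lemma 3 in `o(1)`-form**
(`lemma3_asymptotic_x`): for every `M` there are `C₀, x₀` with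

  `‖𝒯*_R(a,b,d,u,v) − G(0,0) C(u+v,u)(log R)^{u+v+d}/(u+v+d)!‖ ≤ C₀ · B · (log log R)^{5M+1} (log R)^{u+v+d−1}`

for `log log R ≥ x₀`, all `a,b,d,u,v ≤ M` with `a+u, b+v ≥ 1`, and every `G` holomorphic on
`{Re sᵢ > −1/4}` bounded by `B` on the strip `−3/log log R ≤ Re sᵢ ≤ 2` — which is GPY's
(8.4)–(8.6) with the lower-order terms absorbed (for `G` satisfying (8.3), `B = (log log R)^{O(M)}`).
Everything here is PROVED (theorems only).

## References

* D. A. Goldston, J. Pintz, C. Y. Yıldırım, *Primes in tuples. I*, Ann. of Math. (2) 170 (2009),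
  819–862 = arXiv:math/0508185, §8, Lemma 3, (8.4)–(8.6) and (8.14)–(8.24).
  [cite: GoldstonPintzYildirim2009]
-/

noncomputable section

open Complex Filter Topology MeasureTheory Set intervalIntegral
open scoped Real Interval

namespace Literature.NumberTheory.Sieve.GPY

open Literature.Analysis.Complex (rectBoundaryIntegral)
open Literature.NumberTheory.LFunctions.Nicolas (zetaOne zetaOne_zero differentiable_zetaOne zetaOne_of_ne_zero)


section Asymptotic

/-! ### Parameter identities: `R = exp(exp x)`, `y = exp x = log R`, `η = y⁻¹` -/

/-- `log (exp (exp x)) = exp x`. [folklore] -/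
theorem log_exp_exp (x : ℝ) : Real.log (Real.exp (Real.exp x)) = Real.exp x := Real.log_exp _

/-- `exp(exp x)^t = exp(exp x · t)`. [folklore] -/
theorem exp_exp_rpow (x t : ℝ) : Real.exp (Real.exp x) ^ t = Real.exp (Real.exp x * t) := by
  rw [Real.rpow_def_of_pos (Real.exp_pos _), Real.log_exp]

/-- `eˣ · (eˣ)⁻¹ = 1`. [folklore] -/
theorem exp_mul_inv_exp (x : ℝ) : Real.exp x * (Real.exp x)⁻¹ = 1 :=
  mul_inv_cancel₀ (Real.exp_pos x).ne'

/-- `R^{c/log R} = e^c` for `R = exp(exp x)`. [folklore] -/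
theorem exp_exp_rpow_mul_inv (x c : ℝ) :
    Real.exp (Real.exp x) ^ (c * (Real.exp x)⁻¹) = Real.exp c := by
  rw [exp_exp_rpow]; congr 1
  rw [mul_comm c, ← mul_assoc, exp_mul_inv_exp, one_mul]

/-- `y^m / y^n ≤ y^e / y` when `m + 1 ≤ e + n`, `1 ≤ y`. [folklore] -/
theorem pow_div_pow_le_pow_div {y : ℝ} (hy : 1 ≤ y) {m n e : ℕ} (h : m + 1 ≤ e + n) :
    y ^ m / y ^ n ≤ y ^ e / y := by
  have hy0 : 0 < y := by linarith
  rw [div_le_div_iff₀ (by positivity) hy0, ← pow_succ, ← pow_add]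
  exact pow_le_pow_right₀ hy h

/-! ### Term `E_t` -/

/-- **Term `E_t`** (outer truncation): `≤ 2πe⁸ · B · (log R)^{u+v+d−1}` for `2a + b + 1 ≤ A₀`.
[cite: GoldstonPintzYildirim2009, Section 8 eq. 8.6] -/
theorem lemma3ErrT_le {B x : ℝ} (hB : 0 ≤ B) (hx : 0 ≤ x) {A₀ a b d u v : ℕ}
    (hA : 2 * a + b + 1 ≤ A₀) :
    lemma3ErrT B (Real.exp (Real.exp x)) (4 * (Real.exp x)⁻¹) (Real.exp x ^ A₀) a b d u ≤
      2 * Real.pi * Real.exp 8 * B * (Real.exp x ^ (u + v + d) / Real.exp x) := by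
  set y := Real.exp x with hy
  have hy0 : 0 < y := Real.exp_pos x
  have hy1 : 1 ≤ y := Real.one_le_exp hx
  unfold lemma3ErrT lineConst
  have e1 : (3 / (4 * y⁻¹ + 4 * y⁻¹)) ^ d ≤ y ^ d := by
    refine pow_le_pow_left₀ (by positivity) ?_ d
    rw [div_le_iff₀ (by positivity)]; field_simp; nlinarith
  have e2 : (2 / (4 * y⁻¹)) ^ a ≤ y ^ a := by
    refine pow_le_pow_left₀ (by positivity) ?_ a
    rw [div_le_iff₀ (by positivity)]; field_simp; nlinarith
  have e2' : (2 / (4 * y⁻¹)) ^ b ≤ y ^ b := by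
    refine pow_le_pow_left₀ (by positivity) ?_ b
    rw [div_le_iff₀ (by positivity)]; field_simp; nlinarith
  have e3 : Real.exp (Real.exp x) ^ (4 * y⁻¹ + 4 * y⁻¹) = Real.exp 8 := by
    rw [show 4 * y⁻¹ + 4 * y⁻¹ = 8 * (Real.exp x)⁻¹ by rw [hy]; ring, exp_exp_rpow_mul_inv]
  have e4 : Real.pi / (4 * y⁻¹) ^ (u + a) ≤ Real.pi * y ^ (u + a) := by
    rw [div_le_iff₀ (by positivity), mul_assoc, ← mul_pow]
    have : (1 : ℝ) ≤ (y * (4 * y⁻¹)) ^ (u + a) := one_le_pow₀ (by field_simp; norm_num)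
    nlinarith [Real.pi_pos]
  rw [e3]
  calc 2 * (B * ((3 / (4 * y⁻¹ + 4 * y⁻¹)) ^ d * (2 / (4 * y⁻¹)) ^ a * (2 / (4 * y⁻¹)) ^ b) *
        Real.exp 8 * (Real.pi / (4 * y⁻¹) ^ (u + a)) / y ^ A₀)
      ≤ 2 * (B * (y ^ d * y ^ a * y ^ b) * Real.exp 8 * (Real.pi * y ^ (u + a)) / y ^ A₀) := by
        gcongr
    _ = 2 * Real.pi * Real.exp 8 * B * (y ^ (d + a + b + (u + a)) / y ^ A₀) := by ring
    _ ≤ 2 * Real.pi * Real.exp 8 * B * (y ^ (u + v + d) / y) := by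
        refine mul_le_mul_of_nonneg_left (pow_div_pow_le_pow_div hy1 (by omega)) (by positivity)

/-! ### Term `E_P` -/

/-- **Term `E_P`** (perturbation of the double residue): `≤ 1536 e⁴ 6^M · B · x · (log R)^{u+v+d−1}`.
[cite: GoldstonPintzYildirim2009, Section 8 eq. 8.13] -/
theorem lemma3ErrP_le {B x : ℝ} (hB : 0 ≤ B) (hx : 1 ≤ x) {M a b d u v : ℕ} (ha : a ≤ M) (hb : b ≤ M)
    (hd : d ≤ M) :
    lemma3ErrP B (Real.exp (Real.exp x)) (Real.exp x)⁻¹ (1 / x) a b d u v ≤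
      1536 * Real.exp 4 * 6 ^ M * B * x * (Real.exp x ^ (u + v + d) / Real.exp x) := by
  set y := Real.exp x with hy
  have hy0 : 0 < y := Real.exp_pos x
  have hx0 : 0 < x := by linarith
  unfold lemma3ErrP
  rw [log_exp_exp, ← hy]
  have e1 : Real.exp (y * (y⁻¹ + 3 * y⁻¹)) = Real.exp 4 := by
    congr 1; field_simp; ring
  have e2 : 3 * y⁻¹ - 2 * y⁻¹ = y⁻¹ := by ring
  rw [e1, e2]
  have heq : 8 * (3 * y⁻¹) * (8 * y⁻¹ * (B * (3 / 2) ^ d * 2 ^ a * 2 ^ b / (1 / x) * (2 * y⁻¹ + 2 * (3 * y⁻¹)) *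
      Real.exp 4 / (y⁻¹ ^ (u + 1) * (3 * y⁻¹) ^ (v + 1) * y⁻¹ ^ d))) =
      1536 * Real.exp 4 * ((3 / 2) ^ d * 2 ^ a * 2 ^ b / 3 ^ (v + 1)) * B * x *
        (y ^ (u + v + d) / y) := by
    rw [mul_pow 3 y⁻¹, inv_pow, inv_pow, inv_pow]
    field_simp
    ring
  rw [heq]
  have hc : (3 / 2 : ℝ) ^ d * 2 ^ a * 2 ^ b / 3 ^ (v + 1) ≤ 6 ^ M := by
    rw [div_le_iff₀ (by positivity)]
    calc (3 / 2 : ℝ) ^ d * 2 ^ a * 2 ^ b ≤ (3 / 2) ^ M * 2 ^ M * 2 ^ M := by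
          gcongr <;> norm_num
      _ = 6 ^ M * 1 := by rw [← mul_pow, ← mul_pow]; norm_num
      _ ≤ 6 ^ M * 3 ^ (v + 1) := by gcongr; exact one_le_pow₀ (by norm_num)
  have hrest : 0 ≤ B * x * (y ^ (u + v + d) / y) := by positivity
  calc 1536 * Real.exp 4 * ((3 / 2) ^ d * 2 ^ a * 2 ^ b / 3 ^ (v + 1)) * B * x * (y ^ (u + v + d) / y)
      = 1536 * Real.exp 4 * ((3 / 2) ^ d * 2 ^ a * 2 ^ b / 3 ^ (v + 1)) * (B * x * (y ^ (u + v + d) / y)) := by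
        ring
    _ ≤ 1536 * Real.exp 4 * 6 ^ M * (B * x * (y ^ (u + v + d) / y)) := by gcongr
    _ = _ := by ring


/-! ### Small tools -/

/-- `c^k ≤ (max 1 c)^M` for `k ≤ M`, `0 ≤ c`. [folklore] -/
theorem pow_le_max_one_pow {c : ℝ} (hc : 0 ≤ c) {k M : ℕ} (hk : k ≤ M) : c ^ k ≤ (max 1 c) ^ M :=
  (pow_le_pow_left₀ hc (le_max_right 1 c) k).trans (pow_le_pow_right₀ (le_max_left 1 c) hk)

/-- `(c x)^k ≤ (max 1 c)^M x^M` for `k ≤ M`, `0 ≤ c`, `1 ≤ x`. [folklore] -/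
theorem mul_pow_le_max_one_pow {c x : ℝ} (hc : 0 ≤ c) (hx : 1 ≤ x) {k M : ℕ} (hk : k ≤ M) :
    (c * x) ^ k ≤ (max 1 c) ^ M * x ^ M := by
  rw [mul_pow]
  exact mul_le_mul (pow_le_max_one_pow hc hk) (pow_le_pow_right₀ hx hk) (by positivity) (by positivity)

/-- `exp(−(n x)) = (exp x ^ n)⁻¹`. [folklore] -/
theorem exp_neg_nat_mul (n : ℕ) (x : ℝ) : Real.exp (-((n : ℝ) * x)) = (Real.exp x ^ n)⁻¹ := by
  rw [Real.exp_neg, Real.exp_nat_mul]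

/-! ### Term `E_D` (the diagonal) -/

/-- **Term `E_D`** (the diagonal term `I₃`): `≤ c_D(M,C) · B · x^{5M+1} · (log R)^{u+v+d−1}`.
[cite: GoldstonPintzYildirim2009, Section 8 eq. 8.23] -/
theorem lemma3ErrD_le {B C x : ℝ} (hB : 0 ≤ B) (hx : 1 ≤ x) {M a b d u v : ℕ}
    (ha : a ≤ M) (hb : b ≤ M) (hd : d ≤ M) (hu : u ≤ M) (hv : v ≤ M) :
    lemma3ErrD B C (Real.exp (Real.exp x)) (Real.exp x)⁻¹ (1 / x) a b d u v ≤
      96 * Real.exp 1 * (3 / 2) ^ M * (5 * max C 1) ^ (2 * M) * 2 ^ (2 * M + 1) * B * x ^ (5 * M + 1) *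
        (Real.exp x ^ (u + v + d) / Real.exp x) := by
  set y := Real.exp x with hy
  have hy0 : 0 < y := Real.exp_pos x
  have hy1 : 1 ≤ y := Real.one_le_exp (by linarith)
  have hx0 : 0 < x := by linarith
  have hC1 : 1 ≤ 5 * max C 1 := by linarith [le_max_right C 1]
  unfold lemma3ErrD diagConst
  -- the constant `K_r`
  have hR1 : Real.exp (Real.exp x) ^ (y⁻¹ : ℝ) = Real.exp 1 := by
    rw [show (y⁻¹ : ℝ) = 1 * (Real.exp x)⁻¹ by rw [hy, one_mul], exp_exp_rpow_mul_inv]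
  rw [hR1]
  have hK : 8 * y⁻¹ * (B * (3 / (2 * y⁻¹)) ^ d * (5 * max C 1) ^ (a + b) * Real.exp 1 * 2 ^ (u + 1 + a)) ≤
      8 * Real.exp 1 * (3 / 2) ^ M * (5 * max C 1) ^ (2 * M) * 2 ^ (2 * M + 1) * B * (y ^ (u + v + d) / y) := by
    have e1 : (3 / (2 * y⁻¹)) ^ d ≤ (3 / 2) ^ M * y ^ (u + v + d) := by
      rw [show (3 : ℝ) / (2 * y⁻¹) = 3 / 2 * y by field_simp, mul_pow]
      exact mul_le_mul (pow_le_pow_right₀ (by norm_num) hd) (pow_le_pow_right₀ hy1 (by omega))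
        (by positivity) (by positivity)
    have e2 : (5 * max C 1 : ℝ) ^ (a + b) ≤ (5 * max C 1) ^ (2 * M) := pow_le_pow_right₀ hC1 (by omega)
    have e3 : (2 : ℝ) ^ (u + 1 + a) ≤ 2 ^ (2 * M + 1) := pow_le_pow_right₀ (by norm_num) (by omega)
    calc 8 * y⁻¹ * (B * (3 / (2 * y⁻¹)) ^ d * (5 * max C 1) ^ (a + b) * Real.exp 1 * 2 ^ (u + 1 + a))
        = 8 * Real.exp 1 * B * ((3 / (2 * y⁻¹)) ^ d * (5 * max C 1) ^ (a + b) * 2 ^ (u + 1 + a)) * y⁻¹ := by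
          ring
      _ ≤ 8 * Real.exp 1 * B * ((3 / 2) ^ M * y ^ (u + v + d) * (5 * max C 1) ^ (2 * M) * 2 ^ (2 * M + 1)) * y⁻¹ := by
          gcongr
      _ = _ := by rw [div_eq_mul_inv]; ring
  -- the bracket
  have hq : (1 / x) * ((1 / x) ^ ((u + 1 + a) + (v + 1 + b)))⁻¹ = x ^ (u + v + a + b + 1) := by
    rw [show (u + 1 + a) + (v + 1 + b) = (u + v + a + b + 1) + 1 by ring, one_div, inv_pow, inv_inv,
      pow_succ]
    field_simp
  have hb1 : 1 / (((u + v + a + b + 1 : ℕ) : ℝ) * (1 / x) ^ (u + v + a + b + 1)) ≤ x ^ (5 * M + 1) := by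
    rw [one_div_pow, show ((u + v + a + b + 1 : ℕ) : ℝ) * (1 / x ^ (u + v + a + b + 1)) =
      ((u + v + a + b + 1 : ℕ) : ℝ) / x ^ (u + v + a + b + 1) by ring, one_div_div]
    calc x ^ (u + v + a + b + 1) / ((u + v + a + b + 1 : ℕ) : ℝ) ≤ x ^ (u + v + a + b + 1) := by
          refine div_le_self (by positivity) ?_
          exact_mod_cast (by omega : 1 ≤ u + v + a + b + 1)
      _ ≤ x ^ (5 * M + 1) := pow_le_pow_right₀ hx (by omega)
  have hb2 : 1 / (((u + v + 1 : ℕ) : ℝ) * (1 / x) ^ (u + v + 1)) ≤ x ^ (5 * M + 1) := by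
    rw [one_div_pow, show ((u + v + 1 : ℕ) : ℝ) * (1 / x ^ (u + v + 1)) =
      ((u + v + 1 : ℕ) : ℝ) / x ^ (u + v + 1) by ring, one_div_div]
    calc x ^ (u + v + 1) / ((u + v + 1 : ℕ) : ℝ) ≤ x ^ (u + v + 1) := by
          refine div_le_self (by positivity) ?_
          exact_mod_cast (by omega : 1 ≤ u + v + 1)
      _ ≤ x ^ (5 * M + 1) := pow_le_pow_right₀ hx (by omega)
  have hb3 : (1 / x) * ((1 / x) ^ ((u + 1 + a) + (v + 1 + b)))⁻¹ ≤ x ^ (5 * M + 1) := by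
    rw [hq]; exact pow_le_pow_right₀ hx (by omega)
  have hbr : 2 * (1 / (((u + v + a + b + 1 : ℕ) : ℝ) * (1 / x) ^ (u + v + a + b + 1)) +
        1 / (((u + v + 1 : ℕ) : ℝ) * (1 / x) ^ (u + v + 1))) +
      8 * ((1 / x) * ((1 / x) ^ ((u + 1 + a) + (v + 1 + b)))⁻¹) ≤ 12 * x ^ (5 * M + 1) := by
    linarith
  have hKpos : 0 ≤ 8 * y⁻¹ * (B * (3 / (2 * y⁻¹)) ^ d * (5 * max C 1) ^ (a + b) * Real.exp 1 * 2 ^ (u + 1 + a)) := by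
    positivity
  calc _ ≤ (8 * Real.exp 1 * (3 / 2) ^ M * (5 * max C 1) ^ (2 * M) * 2 ^ (2 * M + 1) * B * (y ^ (u + v + d) / y)) *
        (12 * x ^ (5 * M + 1)) :=
        mul_le_mul hK hbr (by positivity) (by positivity)
    _ = _ := by ring

/-! ### Term `E_H` (horizontal connectors of the outer rectangle) -/

/-- **Term `E_H`** (horizontal connectors of the outer rectangle): `≤ c_H · B · x^M · (log R)^{u+v+d−1}`.
[cite: GoldstonPintzYildirim2009, Section 8 eq. 8.17] -/
theorem lemma3ErrH_le {B C x σ ℓ₁ : ℝ} (hB : 0 ≤ B) (hC : 0 ≤ C) (hx : 1 ≤ x) {A₀ M a b d u v : ℕ}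
    (hA : 1 ≤ A₀) (ha : a ≤ M) (hb : b ≤ M) (hd : d ≤ M) (hσ1 : 4 * (Real.exp x)⁻¹ + σ ≤ 1)
    (hℓ₁ : Real.log (Real.exp x ^ A₀ + (Real.exp x)⁻¹ + 3) = ℓ₁) (hℓ0 : 0 ≤ ℓ₁) (hℓ : ℓ₁ ≤ (A₀ + 3) * x)
    (hxy : (A₀ + 3) * x ≤ Real.exp x) :
    lemma3ErrH B C (Real.exp (Real.exp x)) (Real.exp x)⁻¹ (4 * (Real.exp x)⁻¹) σ (Real.exp x ^ A₀) a b d u v ≤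
      8 * Real.exp 5 * (max 1 (1 / 2 + C)) ^ M * 4 ^ M * (max 1 (C * (A₀ + 3))) ^ M * B * x ^ M *
        (Real.exp x ^ (u + v + d) / Real.exp x) := by
  set y := Real.exp x with hy
  have hy0 : 0 < y := Real.exp_pos x
  have hy1 : 1 ≤ y := Real.one_le_exp (by linarith)
  have hx0 : 0 < x := by linarith
  unfold lemma3ErrH
  rw [hℓ₁]
  have hR : Real.exp (Real.exp x) ^ (y⁻¹ + 4 * y⁻¹ : ℝ) = Real.exp 5 := by
    rw [show (y⁻¹ + 4 * y⁻¹ : ℝ) = 5 * (Real.exp x)⁻¹ by rw [hy]; ring, exp_exp_rpow_mul_inv]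
  rw [hR]
  -- factors
  have e1 : (1 / (2 * y⁻¹) + C * ℓ₁) ^ d ≤ (max 1 (1 / 2 + C)) ^ M * y ^ d := by
    have h1 : 1 / (2 * y⁻¹) + C * ℓ₁ ≤ (1 / 2 + C) * y := by
      rw [show (1 : ℝ) / (2 * y⁻¹) = 1 / 2 * y by field_simp]
      have : C * ℓ₁ ≤ C * y := mul_le_mul_of_nonneg_left (hℓ.trans hxy) hC
      linarith
    calc (1 / (2 * y⁻¹) + C * ℓ₁) ^ d ≤ ((1 / 2 + C) * y) ^ d := pow_le_pow_left₀ (by positivity) h1 d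
      _ = (1 / 2 + C) ^ d * y ^ d := mul_pow _ _ _
      _ ≤ (max 1 (1 / 2 + C)) ^ M * y ^ d :=
          mul_le_mul_of_nonneg_right (pow_le_max_one_pow (by positivity) hd) (by positivity)
  have e2 : (4 * y⁻¹) ^ a = 4 ^ a * (y ^ a)⁻¹ := by rw [mul_pow, inv_pow]
  have e3 : (C * ℓ₁) ^ b ≤ (max 1 (C * (A₀ + 3))) ^ M * x ^ M := by
    calc (C * ℓ₁) ^ b ≤ (C * (A₀ + 3) * x) ^ b :=
          pow_le_pow_left₀ (by positivity) (by rw [mul_assoc]; exact mul_le_mul_of_nonneg_left hℓ hC) b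
      _ ≤ (max 1 (C * (A₀ + 3))) ^ M * x ^ M := mul_pow_le_max_one_pow (by positivity) hx hb
  have e4 : ((y ^ A₀) ^ (v + 1 + b))⁻¹ ≤ (y ^ A₀)⁻¹ := by
    refine inv_anti₀ (by positivity) ?_
    calc y ^ A₀ = (y ^ A₀) ^ 1 := (pow_one _).symm
      _ ≤ (y ^ A₀) ^ (v + 1 + b) := pow_le_pow_right₀ (one_le_pow₀ hy1) (by omega)
  have e5 : (4 : ℝ) ^ a ≤ 4 ^ M := pow_le_pow_right₀ (by norm_num) ha
  calc (4 * y⁻¹ + σ) * (8 * y⁻¹ * (B * (1 / (2 * y⁻¹) + C * ℓ₁) ^ d * (4 * y⁻¹) ^ a * (C * ℓ₁) ^ b *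
        Real.exp 5 * ((y⁻¹ ^ (u + 1 + a))⁻¹ * ((y ^ A₀) ^ (v + 1 + b))⁻¹)))
      ≤ 1 * (8 * y⁻¹ * (B * ((max 1 (1 / 2 + C)) ^ M * y ^ d) * (4 ^ a * (y ^ a)⁻¹) *
          ((max 1 (C * (A₀ + 3))) ^ M * x ^ M) * Real.exp 5 * ((y⁻¹ ^ (u + 1 + a))⁻¹ * (y ^ A₀)⁻¹))) := by
        rw [e2]
        gcongr
    _ = 8 * Real.exp 5 * (max 1 (1 / 2 + C)) ^ M * 4 ^ a * (max 1 (C * (A₀ + 3))) ^ M * B * x ^ M *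
          (y ^ (d + (u + 1 + a)) / y ^ (a + 1 + A₀)) := by
        rw [inv_pow, inv_inv]
        field_simp
        ring
    _ ≤ 8 * Real.exp 5 * (max 1 (1 / 2 + C)) ^ M * 4 ^ M * (max 1 (C * (A₀ + 3))) ^ M * B * x ^ M *
          (y ^ (u + v + d) / y) := by
        gcongr 8 * Real.exp 5 * (max 1 (1 / 2 + C)) ^ M * ?_ * (max 1 (C * (A₀ + 3))) ^ M * B * x ^ M * ?_
        exact pow_div_pow_le_pow_div hy1 (by omega)

/-! ### Term `E_L` (left edge of the outer rectangle) -/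

/-- **Term `E_L`** (left edge of the outer rectangle; the saving `R^{η−σ₀} ≤ e · (log R)^{−(M+2)}`):
`≤ c_L · B · x^{3M} · (log R)^{u+v+d−1}`. [cite: GoldstonPintzYildirim2009, Section 8 eq. 8.19] -/
theorem lemma3ErrL_le {B C x cbar ℓ ℓ₁ : ℝ} (hB : 0 ≤ B) (hC : 0 ≤ C) (hx : 1 ≤ x) (hc : 0 < cbar)
    {A₀ M a b d u v : ℕ} (ha : a ≤ M) (hb : b ≤ M) (hd : d ≤ M) (hv : v ≤ M)
    (hℓ₁ : Real.log (Real.exp x ^ A₀ + (Real.exp x)⁻¹ + 3) = ℓ₁) (hℓ₁0 : 0 ≤ ℓ₁) (hℓ₁ℓ : ℓ₁ ≤ (A₀ + 3) * x)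
    (hℓ0 : 0 < ℓ) (hℓ : ℓ ≤ (A₀ + 3) * x) (hxy : (A₀ + 3) * x ≤ Real.exp x)
    (hkey : (M + 2) * x * ℓ ≤ cbar * Real.exp x) :
    lemma3ErrL B C (Real.exp (Real.exp x)) (Real.exp x)⁻¹ (cbar / ℓ) (Real.exp x ^ A₀) a b d u v ≤
      8 * Real.exp 1 * Real.pi * (max 1 (1 / 2 + C)) ^ M * 4 ^ M * (max 1 (C * (A₀ + 3))) ^ M *
        (max 1 ((A₀ + 3) / cbar)) ^ (2 * M) * B * x ^ (3 * M) * (Real.exp x ^ (u + v + d) / Real.exp x) := by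
  set y := Real.exp x with hy
  have hy0 : 0 < y := Real.exp_pos x
  have hy1 : 1 ≤ y := Real.one_le_exp (by linarith)
  have hx0 : 0 < x := by linarith
  unfold lemma3ErrL
  rw [hℓ₁]
  -- the saving `R^{η − σ₀} ≤ e · y^{−(M+2)}`
  have hR : Real.exp (Real.exp x) ^ (y⁻¹ + -(cbar / ℓ) : ℝ) ≤ Real.exp 1 * (y ^ (M + 2))⁻¹ := by
    rw [exp_exp_rpow, ← hy, ← exp_neg_nat_mul, ← Real.exp_add]
    refine Real.exp_le_exp.2 ?_
    rw [mul_add, mul_inv_cancel₀ hy0.ne', add_le_add_iff_left, mul_neg, neg_le_neg_iff,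
      mul_div_assoc', le_div_iff₀ hℓ0]
    push_cast
    linarith
  have e1 : (1 / (2 * y⁻¹) + C * ℓ₁) ^ d ≤ (max 1 (1 / 2 + C)) ^ M * y ^ d := by
    have h1 : 1 / (2 * y⁻¹) + C * ℓ₁ ≤ (1 / 2 + C) * y := by
      rw [show (1 : ℝ) / (2 * y⁻¹) = 1 / 2 * y by field_simp]
      have : C * ℓ₁ ≤ C * y := mul_le_mul_of_nonneg_left (hℓ₁ℓ.trans hxy) hC
      linarith
    calc (1 / (2 * y⁻¹) + C * ℓ₁) ^ d ≤ ((1 / 2 + C) * y) ^ d := pow_le_pow_left₀ (by positivity) h1 d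
      _ = (1 / 2 + C) ^ d * y ^ d := mul_pow _ _ _
      _ ≤ (max 1 (1 / 2 + C)) ^ M * y ^ d :=
          mul_le_mul_of_nonneg_right (pow_le_max_one_pow (by positivity) hd) (by positivity)
  have e2 : (4 * y⁻¹) ^ a = 4 ^ a * (y ^ a)⁻¹ := by rw [mul_pow, inv_pow]
  have e3 : (C * ℓ₁) ^ b ≤ (max 1 (C * (A₀ + 3))) ^ M * x ^ M := by
    calc (C * ℓ₁) ^ b ≤ (C * (A₀ + 3) * x) ^ b :=
          pow_le_pow_left₀ (by positivity) (by rw [mul_assoc]; exact mul_le_mul_of_nonneg_left hℓ₁ℓ hC) b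
      _ ≤ (max 1 (C * (A₀ + 3))) ^ M * x ^ M := mul_pow_le_max_one_pow (by positivity) hx hb
  have e4 : Real.pi / (cbar / ℓ) ^ (v + b) ≤ Real.pi * ((max 1 ((A₀ + 3) / cbar)) ^ (2 * M) * x ^ (2 * M)) := by
    rw [div_eq_mul_inv Real.pi, ← inv_pow, inv_div]
    refine mul_le_mul_of_nonneg_left ?_ Real.pi_pos.le
    calc (ℓ / cbar) ^ (v + b) ≤ ((A₀ + 3) / cbar * x) ^ (v + b) := by
          refine pow_le_pow_left₀ (by positivity) ?_ _
          rw [div_mul_eq_mul_div]; exact div_le_div_of_nonneg_right hℓ hc.le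
      _ ≤ (max 1 ((A₀ + 3) / cbar)) ^ (2 * M) * x ^ (2 * M) := mul_pow_le_max_one_pow (by positivity) hx (by omega)
  have e5 : (4 : ℝ) ^ a ≤ 4 ^ M := pow_le_pow_right₀ (by norm_num) ha
  calc 8 * y⁻¹ * (B * (1 / (2 * y⁻¹) + C * ℓ₁) ^ d * (4 * y⁻¹) ^ a * (C * ℓ₁) ^ b *
        Real.exp (Real.exp x) ^ (y⁻¹ + -(cbar / ℓ) : ℝ) * (y⁻¹ ^ (u + 1 + a))⁻¹) * (Real.pi / (cbar / ℓ) ^ (v + b))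
      ≤ 8 * y⁻¹ * (B * ((max 1 (1 / 2 + C)) ^ M * y ^ d) * (4 ^ a * (y ^ a)⁻¹) *
          ((max 1 (C * (A₀ + 3))) ^ M * x ^ M) * (Real.exp 1 * (y ^ (M + 2))⁻¹) * (y⁻¹ ^ (u + 1 + a))⁻¹) *
          (Real.pi * ((max 1 ((A₀ + 3) / cbar)) ^ (2 * M) * x ^ (2 * M))) := by
        rw [e2]
        gcongr
    _ = 8 * Real.exp 1 * Real.pi * (max 1 (1 / 2 + C)) ^ M * 4 ^ a * (max 1 (C * (A₀ + 3))) ^ M *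
          (max 1 ((A₀ + 3) / cbar)) ^ (2 * M) * B * (x ^ M * x ^ (2 * M)) *
          (y ^ (d + (u + 1 + a)) / y ^ (a + 1 + (M + 2))) := by
        rw [inv_pow, inv_inv]
        field_simp
        ring
    _ ≤ 8 * Real.exp 1 * Real.pi * (max 1 (1 / 2 + C)) ^ M * 4 ^ M * (max 1 (C * (A₀ + 3))) ^ M *
          (max 1 ((A₀ + 3) / cbar)) ^ (2 * M) * B * x ^ (3 * M) * (y ^ (u + v + d) / y) := by
        rw [← pow_add, show M + 2 * M = 3 * M by ring]
        gcongr 8 * Real.exp 1 * Real.pi * (max 1 (1 / 2 + C)) ^ M * ?_ * (max 1 (C * (A₀ + 3))) ^ M *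
          (max 1 ((A₀ + 3) / cbar)) ^ (2 * M) * B * x ^ (3 * M) * ?_
        exact pow_div_pow_le_pow_div hy1 (by omega)


/-! ### Term `E_w` (the inner error), in three parts -/

/-- Tails part of `EwCoef`. [folklore] -/
theorem EwCoef_tail_le {B C x ℓ₃ : ℝ} (hB : 0 ≤ B) (hC : 0 ≤ C) (hx : 1 ≤ x) {A₀ M a b d u : ℕ}
    (ha : a ≤ M) (hb : b ≤ M) (hu : u ≤ M) (hℓ₃0 : 0 ≤ ℓ₃) (hℓ₃ : ℓ₃ ≤ (A₀ + 3) * x) :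
    2 * (B * (3 / (4 * (Real.exp x)⁻¹ + 4 * (Real.exp x)⁻¹)) ^ d * (2 / (4 * (Real.exp x)⁻¹)) ^ a *
        (C * ℓ₃) ^ b * Real.exp 8 * 2 ^ (u + 1 + a)) / (2 * Real.exp x ^ A₀) ≤
      Real.exp 8 * 2 ^ (2 * M + 1) * (max 1 (C * (A₀ + 3))) ^ M * B * x ^ M *
        (Real.exp x ^ (d + a) / Real.exp x ^ A₀) := by
  set y := Real.exp x with hy
  have hy0 : 0 < y := Real.exp_pos x
  have hy1 : 1 ≤ y := Real.one_le_exp (by linarith)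
  have e1 : (3 / (4 * y⁻¹ + 4 * y⁻¹)) ^ d ≤ y ^ d := by
    refine pow_le_pow_left₀ (by positivity) ?_ d
    rw [div_le_iff₀ (by positivity)]; field_simp; nlinarith
  have e2 : (2 / (4 * y⁻¹)) ^ a ≤ y ^ a := by
    refine pow_le_pow_left₀ (by positivity) ?_ a
    rw [div_le_iff₀ (by positivity)]; field_simp; nlinarith
  have e3 : (C * ℓ₃) ^ b ≤ (max 1 (C * (A₀ + 3))) ^ M * x ^ M := by
    calc (C * ℓ₃) ^ b ≤ (C * (A₀ + 3) * x) ^ b :=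
          pow_le_pow_left₀ (by positivity) (by rw [mul_assoc]; exact mul_le_mul_of_nonneg_left hℓ₃ hC) b
      _ ≤ (max 1 (C * (A₀ + 3))) ^ M * x ^ M := mul_pow_le_max_one_pow (by positivity) hx hb
  have e4 : (2 : ℝ) ^ (u + 1 + a) ≤ 2 ^ (2 * M + 1) := pow_le_pow_right₀ (by norm_num) (by omega)
  calc 2 * (B * (3 / (4 * y⁻¹ + 4 * y⁻¹)) ^ d * (2 / (4 * y⁻¹)) ^ a * (C * ℓ₃) ^ b * Real.exp 8 *
        2 ^ (u + 1 + a)) / (2 * y ^ A₀)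
      ≤ 2 * (B * y ^ d * y ^ a * ((max 1 (C * (A₀ + 3))) ^ M * x ^ M) * Real.exp 8 * 2 ^ (2 * M + 1)) /
          (2 * y ^ A₀) := by
        gcongr
    _ = _ := by
        field_simp
        ring

/-- Left-edge part of `EwCoef` (the saving `R^{−σ_w} ≤ y^{−(M+2)}`). [folklore] -/
theorem EwCoef_left_le {B C x cbar ℓ ℓ₃ : ℝ} (hB : 0 ≤ B) (hC : 0 ≤ C) (hx : 1 ≤ x) (hc : 0 < cbar)
    {A₀ M a b d u : ℕ} (ha : a ≤ M) (hb : b ≤ M) (hd : d ≤ M) (hu : u ≤ M) (hℓ₃0 : 0 ≤ ℓ₃)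
    (hℓ₃ : ℓ₃ ≤ (A₀ + 3) * x) (hℓ0 : 0 < ℓ) (hℓ : ℓ ≤ (A₀ + 3) * x)
    (hkey : (M + 2) * x * ℓ ≤ cbar * Real.exp x) :
    B * (1 / (cbar / ℓ) + C * ℓ₃) ^ d * (C * ℓ₃) ^ a * (C * ℓ₃) ^ b *
        Real.exp (Real.exp x) ^ (-(cbar / ℓ)) * (Real.pi / (cbar / ℓ + 4 * (Real.exp x)⁻¹) ^ (u + a)) ≤
      Real.pi * (max 1 ((A₀ + 3) * (1 / cbar + C))) ^ M * (max 1 (C * (A₀ + 3))) ^ (2 * M) *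
        (max 1 ((A₀ + 3) / cbar)) ^ (2 * M) * B * x ^ (5 * M) * (Real.exp x ^ (M + 2))⁻¹ := by
  set y := Real.exp x with hy
  have hy0 : 0 < y := Real.exp_pos x
  have hx0 : 0 < x := by linarith
  have hσ0 : 0 < cbar / ℓ := div_pos hc hℓ0
  -- the saving
  have hR : Real.exp (Real.exp x) ^ (-(cbar / ℓ) : ℝ) ≤ (y ^ (M + 2))⁻¹ := by
    rw [exp_exp_rpow, ← hy, ← exp_neg_nat_mul]
    refine Real.exp_le_exp.2 ?_
    rw [mul_neg, neg_le_neg_iff, mul_div_assoc', le_div_iff₀ hℓ0]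
    push_cast
    linarith
  have e1 : (1 / (cbar / ℓ) + C * ℓ₃) ^ d ≤ (max 1 ((A₀ + 3) * (1 / cbar + C))) ^ M * x ^ M := by
    have h1 : 1 / (cbar / ℓ) + C * ℓ₃ ≤ (A₀ + 3) * (1 / cbar + C) * x := by
      rw [one_div_div]
      have i1 : ℓ / cbar ≤ (A₀ + 3) * x / cbar := div_le_div_of_nonneg_right hℓ hc.le
      have i2 : C * ℓ₃ ≤ C * ((A₀ + 3) * x) := mul_le_mul_of_nonneg_left hℓ₃ hC
      have : (A₀ + 3) * (1 / cbar + C) * x = (A₀ + 3) * x / cbar + C * ((A₀ + 3) * x) := by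
        field_simp
      linarith
    exact (pow_le_pow_left₀ (by positivity) h1 d).trans (mul_pow_le_max_one_pow (by positivity) hx hd)
  have e2 : (C * ℓ₃) ^ a ≤ (max 1 (C * (A₀ + 3))) ^ M * x ^ M := by
    calc (C * ℓ₃) ^ a ≤ (C * (A₀ + 3) * x) ^ a :=
          pow_le_pow_left₀ (by positivity) (by rw [mul_assoc]; exact mul_le_mul_of_nonneg_left hℓ₃ hC) a
      _ ≤ (max 1 (C * (A₀ + 3))) ^ M * x ^ M := mul_pow_le_max_one_pow (by positivity) hx ha
  have e3 : (C * ℓ₃) ^ b ≤ (max 1 (C * (A₀ + 3))) ^ M * x ^ M := by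
    calc (C * ℓ₃) ^ b ≤ (C * (A₀ + 3) * x) ^ b :=
          pow_le_pow_left₀ (by positivity) (by rw [mul_assoc]; exact mul_le_mul_of_nonneg_left hℓ₃ hC) b
      _ ≤ (max 1 (C * (A₀ + 3))) ^ M * x ^ M := mul_pow_le_max_one_pow (by positivity) hx hb
  have e4 : Real.pi / (cbar / ℓ + 4 * y⁻¹) ^ (u + a) ≤
      Real.pi * ((max 1 ((A₀ + 3) / cbar)) ^ (2 * M) * x ^ (2 * M)) := by
    have h1 : Real.pi / (cbar / ℓ + 4 * y⁻¹) ^ (u + a) ≤ Real.pi / (cbar / ℓ) ^ (u + a) := by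
      refine div_le_div_of_nonneg_left Real.pi_pos.le (by positivity) ?_
      exact pow_le_pow_left₀ hσ0.le (by linarith [inv_pos.2 hy0]) _
    refine h1.trans ?_
    rw [div_eq_mul_inv Real.pi, ← inv_pow, inv_div]
    refine mul_le_mul_of_nonneg_left ?_ Real.pi_pos.le
    calc (ℓ / cbar) ^ (u + a) ≤ ((A₀ + 3) / cbar * x) ^ (u + a) := by
          refine pow_le_pow_left₀ (by positivity) ?_ _
          rw [div_mul_eq_mul_div]; exact div_le_div_of_nonneg_right hℓ hc.le
      _ ≤ (max 1 ((A₀ + 3) / cbar)) ^ (2 * M) * x ^ (2 * M) :=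
          mul_pow_le_max_one_pow (by positivity) hx (by omega)
  calc B * (1 / (cbar / ℓ) + C * ℓ₃) ^ d * (C * ℓ₃) ^ a * (C * ℓ₃) ^ b *
        Real.exp (Real.exp x) ^ (-(cbar / ℓ) : ℝ) * (Real.pi / (cbar / ℓ + 4 * y⁻¹) ^ (u + a))
      ≤ B * ((max 1 ((A₀ + 3) * (1 / cbar + C))) ^ M * x ^ M) * ((max 1 (C * (A₀ + 3))) ^ M * x ^ M) *
          ((max 1 (C * (A₀ + 3))) ^ M * x ^ M) * (y ^ (M + 2))⁻¹ *
          (Real.pi * ((max 1 ((A₀ + 3) / cbar)) ^ (2 * M) * x ^ (2 * M))) := by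
        gcongr
    _ = _ := by ring

/-- Horizontal-edges part of `EwCoef`. [folklore] -/
theorem EwCoef_hor_le {B C x cbar ℓ ℓ₃ : ℝ} (hB : 0 ≤ B) (hC : 0 ≤ C) (hx : 1 ≤ x) (hc : 0 < cbar)
    {A₀ M a b d u : ℕ} (hA : 1 ≤ A₀) (ha : a ≤ M) (hb : b ≤ M) (hd : d ≤ M) (hℓ₃0 : 0 ≤ ℓ₃)
    (hℓ₃ : ℓ₃ ≤ (A₀ + 3) * x) (hℓ0 : 0 < ℓ) (hℓ : ℓ ≤ (A₀ + 3) * x)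
    (hsmall : 4 * (Real.exp x)⁻¹ + 4 * (Real.exp x)⁻¹ + cbar / ℓ ≤ 1) :
    2 * ((4 * (Real.exp x)⁻¹ + 4 * (Real.exp x)⁻¹ + cbar / ℓ) *
        (B * (1 / (cbar / ℓ) + C * ℓ₃) ^ d * (C * ℓ₃) ^ a * (C * ℓ₃) ^ b * Real.exp 8 *
          ((2 * Real.exp x ^ A₀ - Real.exp x ^ A₀) ^ (u + 1 + a))⁻¹)) ≤
      2 * Real.exp 8 * (max 1 ((A₀ + 3) * (1 / cbar + C))) ^ M * (max 1 (C * (A₀ + 3))) ^ (2 * M) * B *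
        x ^ (3 * M) * (Real.exp x ^ A₀)⁻¹ := by
  set y := Real.exp x with hy
  have hy0 : 0 < y := Real.exp_pos x
  have hy1 : 1 ≤ y := Real.one_le_exp (by linarith)
  have hx0 : 0 < x := by linarith
  have hσ0 : 0 < cbar / ℓ := div_pos hc hℓ0
  have e1 : (1 / (cbar / ℓ) + C * ℓ₃) ^ d ≤ (max 1 ((A₀ + 3) * (1 / cbar + C))) ^ M * x ^ M := by
    have h1 : 1 / (cbar / ℓ) + C * ℓ₃ ≤ (A₀ + 3) * (1 / cbar + C) * x := by
      rw [one_div_div]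
      have i1 : ℓ / cbar ≤ (A₀ + 3) * x / cbar := div_le_div_of_nonneg_right hℓ hc.le
      have i2 : C * ℓ₃ ≤ C * ((A₀ + 3) * x) := mul_le_mul_of_nonneg_left hℓ₃ hC
      have : (A₀ + 3) * (1 / cbar + C) * x = (A₀ + 3) * x / cbar + C * ((A₀ + 3) * x) := by
        field_simp
      linarith
    exact (pow_le_pow_left₀ (by positivity) h1 d).trans (mul_pow_le_max_one_pow (by positivity) hx hd)
  have e2 : (C * ℓ₃) ^ a ≤ (max 1 (C * (A₀ + 3))) ^ M * x ^ M := by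
    calc (C * ℓ₃) ^ a ≤ (C * (A₀ + 3) * x) ^ a :=
          pow_le_pow_left₀ (by positivity) (by rw [mul_assoc]; exact mul_le_mul_of_nonneg_left hℓ₃ hC) a
      _ ≤ (max 1 (C * (A₀ + 3))) ^ M * x ^ M := mul_pow_le_max_one_pow (by positivity) hx ha
  have e3 : (C * ℓ₃) ^ b ≤ (max 1 (C * (A₀ + 3))) ^ M * x ^ M := by
    calc (C * ℓ₃) ^ b ≤ (C * (A₀ + 3) * x) ^ b :=
          pow_le_pow_left₀ (by positivity) (by rw [mul_assoc]; exact mul_le_mul_of_nonneg_left hℓ₃ hC) b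
      _ ≤ (max 1 (C * (A₀ + 3))) ^ M * x ^ M := mul_pow_le_max_one_pow (by positivity) hx hb
  have e4 : ((y ^ A₀) ^ (u + 1 + a))⁻¹ ≤ (y ^ A₀)⁻¹ := by
    refine inv_anti₀ (by positivity) ?_
    calc y ^ A₀ = (y ^ A₀) ^ 1 := (pow_one _).symm
      _ ≤ (y ^ A₀) ^ (u + 1 + a) := pow_le_pow_right₀ (one_le_pow₀ hy1) (by omega)
  have hpos : 0 ≤ 4 * y⁻¹ + 4 * y⁻¹ + cbar / ℓ := by positivity
  rw [show 2 * y ^ A₀ - y ^ A₀ = y ^ A₀ by ring]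
  calc 2 * ((4 * y⁻¹ + 4 * y⁻¹ + cbar / ℓ) * (B * (1 / (cbar / ℓ) + C * ℓ₃) ^ d * (C * ℓ₃) ^ a * (C * ℓ₃) ^ b *
        Real.exp 8 * ((y ^ A₀) ^ (u + 1 + a))⁻¹))
      ≤ 2 * (1 * (B * ((max 1 ((A₀ + 3) * (1 / cbar + C))) ^ M * x ^ M) * ((max 1 (C * (A₀ + 3))) ^ M * x ^ M) *
          ((max 1 (C * (A₀ + 3))) ^ M * x ^ M) * Real.exp 8 * (y ^ A₀)⁻¹)) := by
        gcongr
    _ = _ := by ring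

/-- **Term `E_w`.** [folklore] -/
theorem lemma3ErrW_le {B C x cbar ℓ ℓ₃ : ℝ} (hB : 0 ≤ B) (hC : 0 ≤ C) (hx : 1 ≤ x) (hc : 0 < cbar)
    {A₀ M a b d u v : ℕ} (hA : 1 ≤ A₀) (hA' : a + b + 1 ≤ A₀) (ha : a ≤ M) (hb : b ≤ M) (hd : d ≤ M)
    (hu : u ≤ M) (hℓ₃e : Real.log (2 * Real.exp x ^ A₀ + Real.exp x ^ A₀ + 3) = ℓ₃) (hℓ₃0 : 0 ≤ ℓ₃)
    (hℓ₃ : ℓ₃ ≤ (A₀ + 3) * x) (hℓ0 : 0 < ℓ) (hℓ : ℓ ≤ (A₀ + 3) * x)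
    (hkey : (M + 2) * x * ℓ ≤ cbar * Real.exp x)
    (hsmall : 4 * (Real.exp x)⁻¹ + 4 * (Real.exp x)⁻¹ + cbar / ℓ ≤ 1) :
    lemma3ErrW B C (Real.exp (Real.exp x)) (4 * (Real.exp x)⁻¹) (cbar / ℓ) (Real.exp x ^ A₀) a b d u v ≤
      (Real.pi * Real.exp 8 * 2 ^ (2 * M + 1) * (max 1 (C * (A₀ + 3))) ^ M +
        Real.pi ^ 2 * (max 1 ((A₀ + 3) * (1 / cbar + C))) ^ M * (max 1 (C * (A₀ + 3))) ^ (2 * M) *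
          (max 1 ((A₀ + 3) / cbar)) ^ (2 * M) +
        2 * Real.pi * Real.exp 8 * (max 1 ((A₀ + 3) * (1 / cbar + C))) ^ M * (max 1 (C * (A₀ + 3))) ^ (2 * M)) *
        B * x ^ (5 * M) * (Real.exp x ^ (u + v + d) / Real.exp x) := by
  set y := Real.exp x with hy
  have hy0 : 0 < y := Real.exp_pos x
  have hy1 : 1 ≤ y := Real.one_le_exp (by linarith)
  have hx0 : 0 < x := by linarith
  set c₁ : ℝ := max 1 (C * (A₀ + 3)) with hc₁
  set c₂ : ℝ := max 1 ((A₀ + 3) * (1 / cbar + C)) with hc₂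
  set c₃ : ℝ := max 1 ((A₀ + 3) / cbar) with hc₃
  unfold lemma3ErrW EwCoef
  rw [hℓ₃e]
  have hR8 : Real.exp (Real.exp x) ^ (4 * y⁻¹ + 4 * y⁻¹ : ℝ) = Real.exp 8 := by
    rw [show (4 * y⁻¹ + 4 * y⁻¹ : ℝ) = 8 * (Real.exp x)⁻¹ by rw [hy]; ring, exp_exp_rpow_mul_inv]
  rw [hR8]
  have hP : Real.pi / (4 * y⁻¹) ^ (v + b) ≤ Real.pi * y ^ (v + b) := by
    rw [div_le_iff₀ (by positivity), mul_assoc, ← mul_pow]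
    have : (1 : ℝ) ≤ (y * (4 * y⁻¹)) ^ (v + b) := one_le_pow₀ (by field_simp; norm_num)
    nlinarith [Real.pi_pos]
  have hW1 := EwCoef_tail_le (d := d) hB hC hx ha hb hu hℓ₃0 hℓ₃ (A₀ := A₀)
  have hW2 := EwCoef_left_le hB hC hx hc ha hb hd hu hℓ₃0 hℓ₃ hℓ0 hℓ hkey
  have hW3 := EwCoef_hor_le (u := u) hB hC hx hc hA ha hb hd hℓ₃0 hℓ₃ hℓ0 hℓ hsmall
  rw [← hy] at hW1 hW2 hW3
  have hW1pos : 0 ≤ 2 * (B * (3 / (4 * y⁻¹ + 4 * y⁻¹)) ^ d * (2 / (4 * y⁻¹)) ^ a * (C * ℓ₃) ^ b * Real.exp 8 *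
      2 ^ (u + 1 + a)) / (2 * y ^ A₀) := by positivity
  have hσ0 : 0 < cbar / ℓ := div_pos hc hℓ0
  have hW2pos : 0 ≤ B * (1 / (cbar / ℓ) + C * ℓ₃) ^ d * (C * ℓ₃) ^ a * (C * ℓ₃) ^ b *
      Real.exp (Real.exp x) ^ (-(cbar / ℓ) : ℝ) * (Real.pi / (cbar / ℓ + 4 * y⁻¹) ^ (u + a)) := by positivity
  have hW3pos : 0 ≤ 2 * ((4 * y⁻¹ + 4 * y⁻¹ + cbar / ℓ) * (B * (1 / (cbar / ℓ) + C * ℓ₃) ^ d * (C * ℓ₃) ^ a *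
      (C * ℓ₃) ^ b * Real.exp 8 * ((2 * y ^ A₀ - y ^ A₀) ^ (u + 1 + a))⁻¹)) := by
    have : 0 < 2 * y ^ A₀ - y ^ A₀ := by rw [show 2 * y ^ A₀ - y ^ A₀ = y ^ A₀ by ring]; positivity
    positivity
  -- multiply out
  have hx1 : x ^ M ≤ x ^ (5 * M) := pow_le_pow_right₀ hx (by omega)
  have hx3 : x ^ (3 * M) ≤ x ^ (5 * M) := pow_le_pow_right₀ hx (by omega)
  have hy1' : y ^ (d + a) / y ^ A₀ * y ^ (v + b) ≤ y ^ (u + v + d) / y := by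
    rw [div_mul_eq_mul_div, ← pow_add]; exact pow_div_pow_le_pow_div hy1 (by omega)
  have hy2' : (y ^ (M + 2))⁻¹ * y ^ (v + b) ≤ y ^ (u + v + d) / y := by
    rw [inv_mul_eq_div]
    exact pow_div_pow_le_pow_div hy1 (by omega)
  have hy3' : (y ^ A₀)⁻¹ * y ^ (v + b) ≤ y ^ (u + v + d) / y := by
    rw [inv_mul_eq_div]
    exact pow_div_pow_le_pow_div hy1 (by omega)
  calc _ ≤ (Real.exp 8 * 2 ^ (2 * M + 1) * c₁ ^ M * B * x ^ M * (y ^ (d + a) / y ^ A₀) +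
          Real.pi * c₂ ^ M * c₁ ^ (2 * M) * c₃ ^ (2 * M) * B * x ^ (5 * M) * (y ^ (M + 2))⁻¹ +
          2 * Real.exp 8 * c₂ ^ M * c₁ ^ (2 * M) * B * x ^ (3 * M) * (y ^ A₀)⁻¹) * (Real.pi * y ^ (v + b)) := by
        exact mul_le_mul (add_le_add (add_le_add hW1 hW2) hW3) hP (by positivity) (by positivity)
    _ = Real.pi * Real.exp 8 * 2 ^ (2 * M + 1) * c₁ ^ M * B * x ^ M * (y ^ (d + a) / y ^ A₀ * y ^ (v + b)) +
          Real.pi ^ 2 * c₂ ^ M * c₁ ^ (2 * M) * c₃ ^ (2 * M) * B * x ^ (5 * M) * ((y ^ (M + 2))⁻¹ * y ^ (v + b)) +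
          2 * Real.pi * Real.exp 8 * c₂ ^ M * c₁ ^ (2 * M) * B * x ^ (3 * M) * ((y ^ A₀)⁻¹ * y ^ (v + b)) := by
        ring
    _ ≤ Real.pi * Real.exp 8 * 2 ^ (2 * M + 1) * c₁ ^ M * B * x ^ (5 * M) * (y ^ (u + v + d) / y) +
          Real.pi ^ 2 * c₂ ^ M * c₁ ^ (2 * M) * c₃ ^ (2 * M) * B * x ^ (5 * M) * (y ^ (u + v + d) / y) +
          2 * Real.pi * Real.exp 8 * c₂ ^ M * c₁ ^ (2 * M) * B * x ^ (5 * M) * (y ^ (u + v + d) / y) := by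
        gcongr
    _ = _ := by ring


/-! ### Feasibility of the parameter choice -/

/-- `log 8 ≤ 3`. [folklore] -/
theorem log_eight_le_three : Real.log 8 ≤ 3 := by
  rw [Real.log_le_iff_le_exp (by norm_num)]
  have := Real.quadratic_le_exp_of_nonneg (by norm_num : (0 : ℝ) ≤ 3)
  linarith

/-- `log 4 ≤ 2`. [folklore] -/
theorem log_four_le_two : Real.log 4 ≤ 2 := by
  rw [Real.log_le_iff_le_exp (by norm_num)]
  have := Real.quadratic_le_exp_of_nonneg (by norm_num : (0 : ℝ) ≤ 2)
  linarith

/-- `log (c · y^A) ≤ (A + 3) x` for `y = exp x`, `x ≥ 1`, `0 < c ≤ 8`. [folklore] -/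
theorem log_mul_pow_exp_le {c x : ℝ} (hc : 0 < c) (hc8 : c ≤ 8) (hx : 1 ≤ x) (A : ℕ) :
    Real.log (c * Real.exp x ^ A) ≤ (A + 3) * x := by
  rw [Real.log_mul hc.ne' (pow_ne_zero _ (Real.exp_pos x).ne'), ← Real.exp_nat_mul, Real.log_exp]
  have : Real.log c ≤ 3 := (Real.log_le_log hc hc8).trans log_eight_le_three
  nlinarith

/-- **The parameters are admissible for large `x`.** With `y = exp x`, `ℓ = log(3y^{A₀}+5)`:
if `x ≥ 1` and `4(M+2)(A₀+3) x² ≤ c̄ y` (`0 < c̄ ≤ 1`, `A₀ ≥ 1`) then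
`(A₀+3)x ≤ y`, `0 < ℓ`, `A₀ x ≤ ℓ ≤ (A₀+3)x`, `4ℓ ≤ c̄ y`, `(M+2) x ℓ ≤ c̄ y`, and the two auxiliary
logarithms `log(y^{A₀} + y⁻¹ + 3)`, `log(3y^{A₀} + 3)` lie in `[0, (A₀+3)x]`. [folklore] -/
theorem lemma3_params {cbar x : ℝ} {M A₀ : ℕ} (hc1 : cbar ≤ 1) (hA : 1 ≤ A₀) (hx : 1 ≤ x)
    (hbig : 4 * (M + 2) * (A₀ + 3) * x ^ 2 ≤ cbar * Real.exp x) :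
    (A₀ + 3) * x ≤ Real.exp x ∧
    0 < Real.log (3 * Real.exp x ^ A₀ + 5) ∧
    (A₀ : ℝ) * x ≤ Real.log (3 * Real.exp x ^ A₀ + 5) ∧
    Real.log (3 * Real.exp x ^ A₀ + 5) ≤ (A₀ + 3) * x ∧
    4 * Real.log (3 * Real.exp x ^ A₀ + 5) ≤ cbar * Real.exp x ∧
    (M + 2) * x * Real.log (3 * Real.exp x ^ A₀ + 5) ≤ cbar * Real.exp x ∧
    0 ≤ Real.log (Real.exp x ^ A₀ + (Real.exp x)⁻¹ + 3) ∧
    Real.log (Real.exp x ^ A₀ + (Real.exp x)⁻¹ + 3) ≤ (A₀ + 3) * x ∧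
    0 ≤ Real.log (2 * Real.exp x ^ A₀ + Real.exp x ^ A₀ + 3) ∧
    Real.log (2 * Real.exp x ^ A₀ + Real.exp x ^ A₀ + 3) ≤ (A₀ + 3) * x := by
  set y := Real.exp x with hy
  have hy0 : 0 < y := Real.exp_pos x
  have hy1 : 1 ≤ y := Real.one_le_exp (by linarith)
  have hyA : 1 ≤ y ^ A₀ := one_le_pow₀ hy1
  have hyinv : y⁻¹ ≤ 1 := inv_le_one_of_one_le₀ hy1
  have hA3 : (4 : ℝ) ≤ A₀ + 3 := by
    have : (1 : ℝ) ≤ A₀ := by exact_mod_cast hA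
    linarith
  have hM2 : (2 : ℝ) ≤ M + 2 := by
    have h0 : (0 : ℝ) ≤ M := Nat.cast_nonneg M
    linarith
  -- `(A₀+3) x ≤ (A₀+3) x² ≤ 4(M+2)(A₀+3)x² ≤ c̄ y ≤ y`
  have hx2 : x ≤ x ^ 2 := by nlinarith
  have hxy : (A₀ + 3) * x ≤ y := by
    have h1 : (A₀ + 3) * x ≤ (A₀ + 3) * x ^ 2 := mul_le_mul_of_nonneg_left hx2 (by positivity)
    have h2 : (A₀ + 3) * x ^ 2 ≤ 4 * (M + 2) * (A₀ + 3) * x ^ 2 := by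
      have h41 : (1 : ℝ) ≤ 4 * (M + 2) := by linarith
      have hpos : 0 ≤ (A₀ + 3) * x ^ 2 := by positivity
      calc (A₀ + 3) * x ^ 2 = 1 * ((A₀ + 3) * x ^ 2) := (one_mul _).symm
        _ ≤ 4 * (M + 2) * ((A₀ + 3) * x ^ 2) := mul_le_mul_of_nonneg_right h41 hpos
        _ = _ := by ring
    have h3 : cbar * y ≤ y := by nlinarith
    linarith
  -- the master logarithm
  have hℓhi : Real.log (3 * y ^ A₀ + 5) ≤ (A₀ + 3) * x := by
    calc Real.log (3 * y ^ A₀ + 5) ≤ Real.log (8 * y ^ A₀) :=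
          Real.log_le_log (by positivity) (by linarith)
      _ ≤ (A₀ + 3) * x := log_mul_pow_exp_le (by norm_num) (by norm_num) hx A₀
  have hℓlo : (A₀ : ℝ) * x ≤ Real.log (3 * y ^ A₀ + 5) := by
    have : Real.log (y ^ A₀) = A₀ * x := by rw [hy, ← Real.exp_nat_mul, Real.log_exp]
    rw [← this]
    exact Real.log_le_log (by positivity) (by linarith)
  have hℓ0 : 0 < Real.log (3 * y ^ A₀ + 5) := Real.log_pos (by linarith)
  have h4ℓ : 4 * Real.log (3 * y ^ A₀ + 5) ≤ cbar * y := by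
    calc 4 * Real.log (3 * y ^ A₀ + 5) ≤ 4 * ((A₀ + 3) * x) := by linarith
      _ ≤ 4 * (M + 2) * (A₀ + 3) * x ^ 2 := by
          have : 4 * ((A₀ + 3) * x) ≤ 4 * ((A₀ + 3) * x ^ 2) := by
            have := mul_le_mul_of_nonneg_left hx2 (by positivity : (0 : ℝ) ≤ A₀ + 3); linarith
          have h' : 4 * ((A₀ + 3) * x ^ 2) ≤ 4 * (M + 2) * (A₀ + 3) * x ^ 2 := by
            have : (1 : ℝ) * ((A₀ + 3) * x ^ 2) ≤ (M + 2) * ((A₀ + 3) * x ^ 2) :=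
              mul_le_mul_of_nonneg_right (by linarith) (by positivity)
            linarith
          linarith
      _ ≤ cbar * y := hbig
  have hkey : (M + 2) * x * Real.log (3 * y ^ A₀ + 5) ≤ cbar * y := by
    calc (M + 2) * x * Real.log (3 * y ^ A₀ + 5) ≤ (M + 2) * x * ((A₀ + 3) * x) :=
          mul_le_mul_of_nonneg_left hℓhi (by positivity)
      _ = (M + 2) * (A₀ + 3) * x ^ 2 := by ring
      _ ≤ 4 * (M + 2) * (A₀ + 3) * x ^ 2 := by
          have : 0 ≤ (M + 2) * (A₀ + 3) * x ^ 2 := by positivity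
          linarith
      _ ≤ cbar * y := hbig
  have hℓ₁hi : Real.log (y ^ A₀ + y⁻¹ + 3) ≤ (A₀ + 3) * x := by
    calc Real.log (y ^ A₀ + y⁻¹ + 3) ≤ Real.log (8 * y ^ A₀) :=
          Real.log_le_log (by positivity) (by linarith)
      _ ≤ (A₀ + 3) * x := log_mul_pow_exp_le (by norm_num) (by norm_num) hx A₀
  have hℓ₁lo : 0 ≤ Real.log (y ^ A₀ + y⁻¹ + 3) := Real.log_nonneg (by linarith [inv_pos.2 hy0])
  have hℓ₃hi : Real.log (2 * y ^ A₀ + y ^ A₀ + 3) ≤ (A₀ + 3) * x := by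
    calc Real.log (2 * y ^ A₀ + y ^ A₀ + 3) ≤ Real.log (8 * y ^ A₀) :=
          Real.log_le_log (by positivity) (by linarith)
      _ ≤ (A₀ + 3) * x := log_mul_pow_exp_le (by norm_num) (by norm_num) hx A₀
  have hℓ₃lo : 0 ≤ Real.log (2 * y ^ A₀ + y ^ A₀ + 3) := Real.log_nonneg (by linarith)
  exact ⟨hxy, hℓ0, hℓlo, hℓhi, h4ℓ, hkey, hℓ₁lo, hℓ₁hi, hℓ₃lo, hℓ₃hi⟩

/-- Largeness: there is `x₀` with `4(M+2)(A₀+3)x² ≤ c̄ eˣ` for `x ≥ x₀` (from `x³/6 ≤ eˣ`). [folklore] -/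
theorem exists_sq_le_exp (cbar : ℝ) (hc : 0 < cbar) (M A₀ : ℕ) :
    ∃ x₀ : ℝ, 1 ≤ x₀ ∧ ∀ x, x₀ ≤ x → 4 * (M + 2) * (A₀ + 3) * x ^ 2 ≤ cbar * Real.exp x := by
  refine ⟨max 1 (6 * (4 * (M + 2) * (A₀ + 3)) / cbar), le_max_left _ _, fun x hx => ?_⟩
  have hx1 : 1 ≤ x := (le_max_left _ _).trans hx
  have hx2 : 6 * (4 * (M + 2) * (A₀ + 3)) / cbar ≤ x := (le_max_right _ _).trans hx
  have h3 := Real.pow_div_factorial_le_exp x (by linarith : (0 : ℝ) ≤ x) 3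
  have hfac : ((Nat.factorial 3 : ℕ) : ℝ) = 6 := by norm_num [Nat.factorial]
  rw [hfac] at h3
  rw [div_le_iff₀ hc] at hx2
  -- `4(M+2)(A₀+3) x² · 6 ≤ c̄ x · x² = c̄ x³ ≤ 6 c̄ eˣ`
  have h0 : 0 ≤ 4 * ((M : ℝ) + 2) * (A₀ + 3) := by positivity
  nlinarith [sq_nonneg x, mul_le_mul_of_nonneg_right hx2 (sq_nonneg x), h3, hc]


/-! ### The `o(1)`-form of Lemma 3 -/

set_option maxHeartbeats 800000 in
/-- **Lemma 3, asymptotic form in the variable `x = log log R`.** For every `M` there are `C₀, x₀`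
such that for `x ≥ x₀`, `R = exp(exp x)`, all `a, b, d, u, v ≤ M` with `a + u ≥ 1`, `b + v ≥ 1`,
every `G` holomorphic on `{Re sᵢ > −1/4}` and every `B ≥ 0` bounding `|G|` on the strip
`−3/x ≤ Re sᵢ ≤ 2`:
`‖𝒯*_R(a,b,d,u,v) − G(0,0) C(u+v,u)(log R)^{u+v+d}/(u+v+d)!‖ ≤ C₀ B x^{5M+1} (log R)^{u+v+d}/log R`.
[cite: GoldstonPintzYildirim2009, Lemma 3] -/
theorem lemma3_asymptotic_x (M : ℕ) :
    ∃ C₀ x₀ : ℝ, 0 ≤ C₀ ∧ 48 ≤ x₀ ∧ ∀ x : ℝ, x₀ ≤ x →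
      ∀ (a b d u v : ℕ), a ≤ M → b ≤ M → d ≤ M → u ≤ M → v ≤ M → 1 ≤ a + u → 1 ≤ b + v →
      ∀ (G : ℂ → ℂ → ℂ) (B : ℝ), 0 ≤ B → DifferentiableOn ℂ (fun z : ℂ × ℂ => G z.1 z.2) G₂Region →
      (∀ s₁ s₂ : ℂ, -(3 / x) ≤ s₁.re → s₁.re ≤ 2 → -(3 / x) ≤ s₂.re → s₂.re ≤ 2 → ‖G s₁ s₂‖ ≤ B) →
      ‖lemma3T G (Real.exp (Real.exp x)) a b d u v -
          G 0 0 * ((((u + v).choose u : ℕ) : ℂ) * (Real.log (Real.exp (Real.exp x)) : ℂ) ^ (u + v + d) /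
            ((u + v + d).factorial : ℂ))‖ ≤
        C₀ * B * x ^ (5 * M + 1) * (Real.exp x ^ (u + v + d) / Real.exp x) := by
  obtain ⟨cbar, C, hc0, hc100, hC0, hWz⟩ := exists_zetaOne_bounds
  obtain ⟨ρW, hρW0, hρ⟩ := exists_norm_zetaOne_near_zero
  obtain ⟨A₀, hA₀⟩ : ∃ A₀ : ℕ, A₀ = 3 * M + 3 := ⟨_, rfl⟩
  obtain ⟨x₁, hx₁1, hbig⟩ := exists_sq_le_exp cbar hc0 M A₀
  -- the constants of the six error terms
  obtain ⟨cT, hcT⟩ : ∃ c : ℝ, c = 2 * Real.pi * Real.exp 8 := ⟨_, rfl⟩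
  obtain ⟨cW, hcW⟩ : ∃ c : ℝ, c = Real.pi * Real.exp 8 * 2 ^ (2 * M + 1) * (max 1 (C * (A₀ + 3))) ^ M +
      Real.pi ^ 2 * (max 1 ((A₀ + 3) * (1 / cbar + C))) ^ M * (max 1 (C * (A₀ + 3))) ^ (2 * M) *
        (max 1 ((A₀ + 3) / cbar)) ^ (2 * M) +
      2 * Real.pi * Real.exp 8 * (max 1 ((A₀ + 3) * (1 / cbar + C))) ^ M * (max 1 (C * (A₀ + 3))) ^ (2 * M) :=
    ⟨_, rfl⟩
  obtain ⟨cP, hcP⟩ : ∃ c : ℝ, c = 1536 * Real.exp 4 * 6 ^ M := ⟨_, rfl⟩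
  obtain ⟨cH, hcH⟩ : ∃ c : ℝ, c = 8 * Real.exp 5 * (max 1 (1 / 2 + C)) ^ M * 4 ^ M *
      (max 1 (C * (A₀ + 3))) ^ M := ⟨_, rfl⟩
  obtain ⟨cL, hcL⟩ : ∃ c : ℝ, c = 8 * Real.exp 1 * Real.pi * (max 1 (1 / 2 + C)) ^ M * 4 ^ M *
      (max 1 (C * (A₀ + 3))) ^ M * (max 1 ((A₀ + 3) / cbar)) ^ (2 * M) := ⟨_, rfl⟩
  obtain ⟨cD, hcD⟩ : ∃ c : ℝ, c = 96 * Real.exp 1 * (3 / 2) ^ M * (5 * max C 1) ^ (2 * M) * 2 ^ (2 * M + 1) :=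
    ⟨_, rfl⟩
  have hcT0 : 0 ≤ cT := by rw [hcT]; positivity
  have hcW0 : 0 ≤ cW := by rw [hcW]; positivity
  have hcP0 : 0 ≤ cP := by rw [hcP]; positivity
  have hcH0 : 0 ≤ cH := by rw [hcH]; positivity
  have hcL0 : 0 ≤ cL := by rw [hcL]; positivity
  have hcD0 : 0 ≤ cD := by rw [hcD]; positivity
  refine ⟨1 / (2 * Real.pi) ^ 2 * (cT + cW + cP + 2 * cH + cL + cD),
    max (max 48 x₁) (max (6 / ρW) (3 / (2 * cbar))), by positivity, ?_, ?_⟩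
  · exact le_trans (le_max_left _ _) (le_max_left _ _)
  intro x hx a b d u v ha hb hd hu hv hau hbv G B hB hG hGB
  have hx48 : 48 ≤ x := le_trans (le_trans (le_max_left _ _) (le_max_left _ _)) hx
  have hxx₁ : x₁ ≤ x := le_trans (le_trans (le_max_right _ _) (le_max_left _ _)) hx
  have hxρ : 6 / ρW ≤ x := le_trans (le_trans (le_max_left _ _) (le_max_right _ _)) hx
  have hxc : 3 / (2 * cbar) ≤ x := le_trans (le_trans (le_max_right _ _) (le_max_right _ _)) hx
  have hx1 : 1 ≤ x := by linarith
  have hx0 : 0 < x := by linarith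
  have hM1 : 1 ≤ M := by omega
  have hA1 : 1 ≤ A₀ := by omega
  have hy0 : 0 < Real.exp x := Real.exp_pos x
  have hy1 : 1 ≤ Real.exp x := Real.one_le_exp (by linarith)
  obtain ⟨hxy, hℓ0, hℓlo, hℓhi, h4ℓ, hkey, hℓ₁lo, hℓ₁hi, hℓ₃lo, hℓ₃hi⟩ :=
    lemma3_params (M := M) (A₀ := A₀) (by linarith) hA1 hx1 (hbig x hxx₁)
  obtain ⟨ℓ, hℓdef⟩ : ∃ ℓ : ℝ, Real.log (3 * Real.exp x ^ A₀ + 5) = ℓ := ⟨_, rfl⟩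
  rw [hℓdef] at hℓ0 hℓlo hℓhi h4ℓ hkey
  -- elementary consequences
  have hA3 : (9 : ℝ) ≤ A₀ + 3 := by
    have h6 : (6 : ℝ) ≤ A₀ := by
      rw [hA₀]; push_cast
      have : (1 : ℝ) ≤ M := by exact_mod_cast hM1
      linarith
    linarith
  have h9x : 9 * x ≤ (A₀ + 3) * x := mul_le_mul_of_nonneg_right hA3 hx0.le
  have h4x : 4 * x ≤ Real.exp x := by linarith
  have h6x : 6 * x < Real.exp x := by linarith
  have hσpos : 0 < cbar / ℓ := div_pos hc0 hℓ0
  have h4y : 4 * (Real.exp x)⁻¹ ≤ 1 / x := by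
    rw [show (4 : ℝ) * (Real.exp x)⁻¹ = 4 / Real.exp x by ring, div_le_div_iff₀ hy0 hx0]; linarith
  have hyinv0 : 0 < (Real.exp x)⁻¹ := inv_pos.2 hy0
  have hyx : (Real.exp x)⁻¹ ≤ 1 / x := by linarith
  have h4σ : 4 * (Real.exp x)⁻¹ ≤ cbar / ℓ := by
    rw [show (4 : ℝ) * (Real.exp x)⁻¹ = 4 / Real.exp x by ring, div_le_div_iff₀ hy0 hℓ0]; linarith
  have hℓ1 : 1 ≤ ℓ := by
    have : (1 : ℝ) * 1 ≤ (A₀ : ℝ) * x := mul_le_mul (by exact_mod_cast hA1) hx1 zero_le_one (by positivity)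
    linarith
  have hσ100 : cbar / ℓ ≤ 1 / 100 := by
    calc cbar / ℓ ≤ cbar / 1 := div_le_div_of_nonneg_left hc0.le one_pos hℓ1
      _ ≤ 1 / 100 := by rw [div_one]; exact hc100
  have hσx : cbar / ℓ ≤ 1 / x := by
    rw [div_le_div_iff₀ hℓ0 hx0]
    have h1 : (1 : ℝ) * x ≤ (A₀ : ℝ) * x := mul_le_mul_of_nonneg_right (by exact_mod_cast hA1) hx0.le
    have h2 : cbar * x ≤ x := mul_le_of_le_one_left hx0.le (by linarith)
    linarith
  have hx20 : 1 / x ≤ 1 / 20 := one_div_le_one_div_of_le (by norm_num) (by linarith)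
  have hx0' : 0 ≤ 1 / x := by positivity
  have hρW6 : 6 * (1 / x) ≤ ρW := by
    rw [mul_one_div, div_le_iff₀ hx0]; rw [div_le_iff₀ hρW0] at hxρ; linarith
  have hZ2 : (Real.exp x)⁻¹ + 2 * (1 / x) ≤ 4 * cbar / Real.log 4 := by
    have hl4 : 0 < Real.log 4 := Real.log_pos (by norm_num)
    have h1 : 2 * cbar ≤ 4 * cbar / Real.log 4 := by
      rw [le_div_iff₀ hl4]; nlinarith [log_four_le_two, hc0]
    have h2 : 3 * (1 / x) ≤ 2 * cbar := by
      rw [mul_one_div, div_le_iff₀ hx0]; rw [div_le_iff₀ (by linarith : (0 : ℝ) < 2 * cbar)] at hxc; linarith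
    linarith
  have h3x : (3 : ℝ) / x = 3 * (1 / x) := by ring
  -- the explicit bound with these parameters
  have hmain := norm_lemma3T_sub_main_le hWz hc0.le hC0.le hρ hG hB hGB (R := Real.exp (Real.exp x))
    (Real.one_le_exp (Real.exp_pos x).le) hau hbv (d := d) (η := (Real.exp x)⁻¹) (θ := 4 * (Real.exp x)⁻¹)
    (η₀ := 1 / x) (σw := cbar / ℓ) (σ₀ := cbar / ℓ) (ρ := 1 / x) (T := Real.exp x ^ A₀)
    hyinv0 le_rfl h4y hx20
    (by rw [show (6 : ℝ) * (Real.exp x)⁻¹ = 6 / Real.exp x by ring, div_lt_div_iff₀ hy0 hx0]; linarith)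
    hρW6 (one_div_lt_one_div_of_lt (by norm_num) (by linarith)) h4σ h4σ (hσ100.trans (by norm_num))
    (by linarith) (by linarith) (one_le_pow₀ hy1)
    (by rw [hℓdef, show 4 * cbar / ℓ = 4 * (cbar / ℓ) by ring]; linarith)
    hZ2 (by rw [h3x]; linarith) (by rw [h3x]; linarith) (by rw [h3x]; linarith) (by rw [h3x]; linarith)
  refine hmain.trans ?_
  -- the six error terms
  have hT' := lemma3ErrT_le (d := d) (u := u) (v := v) hB hx0.le (A₀ := A₀) (a := a) (b := b) (by omega)
  have hW' := lemma3ErrW_le (v := v) hB hC0.le hx1 hc0 hA1 (by omega) ha hb hd hu rfl hℓ₃lo hℓ₃hi hℓ0 hℓhi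
    hkey (by linarith)
  have hP' := lemma3ErrP_le (u := u) (v := v) hB hx1 ha hb hd
  have hH' := lemma3ErrH_le (u := u) (v := v) hB hC0.le hx1 hA1 ha hb hd (σ := cbar / ℓ) (by linarith) rfl
    hℓ₁lo hℓ₁hi hxy
  have hL' := lemma3ErrL_le (u := u) hB hC0.le hx1 hc0 ha hb hd hv rfl hℓ₁lo hℓ₁hi hℓ0 hℓhi hxy hkey
  have hD' := lemma3ErrD_le (C := C) hB hx1 ha hb hd hu hv
  rw [← hcT] at hT'
  rw [← hcW] at hW'
  rw [← hcP] at hP'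
  rw [← hcH] at hH'
  rw [← hcL] at hL'
  rw [← hcD] at hD'
  -- raise all powers of `x` to `5M + 1`
  set X : ℝ := x ^ (5 * M + 1) with hX
  set F : ℝ := Real.exp x ^ (u + v + d) / Real.exp x with hF
  have hF0 : 0 ≤ F := by positivity
  have hX1 : 1 ≤ X := one_le_pow₀ hx1
  have hxX : x ≤ X := le_self_pow₀ hx1 (by omega)
  have hMX : x ^ M ≤ X := pow_le_pow_right₀ hx1 (by omega)
  have h3MX : x ^ (3 * M) ≤ X := pow_le_pow_right₀ hx1 (by omega)
  have h5MX : x ^ (5 * M) ≤ X := pow_le_pow_right₀ hx1 (by omega)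
  have hT'' : lemma3ErrT B (Real.exp (Real.exp x)) (4 * (Real.exp x)⁻¹) (Real.exp x ^ A₀) a b d u ≤
      cT * B * X * F :=
    hT'.trans (mul_le_mul_of_nonneg_right (le_mul_of_one_le_right (by positivity) hX1) hF0)
  have hW'' : lemma3ErrW B C (Real.exp (Real.exp x)) (4 * (Real.exp x)⁻¹) (cbar / ℓ) (Real.exp x ^ A₀) a b d u v ≤
      cW * B * X * F :=
    hW'.trans (mul_le_mul_of_nonneg_right (mul_le_mul_of_nonneg_left h5MX (by positivity)) hF0)
  have hP'' : lemma3ErrP B (Real.exp (Real.exp x)) (Real.exp x)⁻¹ (1 / x) a b d u v ≤ cP * B * X * F :=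
    hP'.trans (mul_le_mul_of_nonneg_right (mul_le_mul_of_nonneg_left hxX (by positivity)) hF0)
  have hH'' : lemma3ErrH B C (Real.exp (Real.exp x)) (Real.exp x)⁻¹ (4 * (Real.exp x)⁻¹) (cbar / ℓ)
      (Real.exp x ^ A₀) a b d u v ≤ cH * B * X * F :=
    hH'.trans (mul_le_mul_of_nonneg_right (mul_le_mul_of_nonneg_left hMX (by positivity)) hF0)
  have hL'' : lemma3ErrL B C (Real.exp (Real.exp x)) (Real.exp x)⁻¹ (cbar / ℓ) (Real.exp x ^ A₀) a b d u v ≤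
      cL * B * X * F :=
    hL'.trans (mul_le_mul_of_nonneg_right (mul_le_mul_of_nonneg_left h3MX (by positivity)) hF0)
  have hD'' : lemma3ErrD B C (Real.exp (Real.exp x)) (Real.exp x)⁻¹ (1 / x) a b d u v ≤ cD * B * X * F := hD'
  unfold lemma3Err
  rw [show 1 / (2 * Real.pi) ^ 2 * (cT + cW + cP + 2 * cH + cL + cD) * B * X * F =
    1 / (2 * Real.pi) ^ 2 * ((cT + cW + cP + 2 * cH + cL + cD) * B * X * F) by ring]
  refine mul_le_mul_of_nonneg_left ?_ (by positivity)
  linear_combination hT'' + hW'' + hP'' + 2 * hH'' + hL'' + hD''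

end Asymptotic

end Literature.NumberTheory.Sieve.GPY
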